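import Mathlib.Analysis.Complex.Polynomial.Basic
import Literature.NumberTheory.GaloisRepresentations.AbsGaloisGroup
import Literature.NumberTheory.GaloisRepresentations.ContinuousH1OrderTwo
import HarnessLib

/-!
# The restriction `Γ_{K_w} → Γ_K` at a real place is a complex conjugation at `w`

Let `K` be a number field (any field with a real place suffices) and `w` a real infinite place,
`K_w = w.Completion ≅ ℝ`.  The tree computes the localisation `Hⁿ(K, M) → Hⁿ(K_w, M)` along the FIXED
continuous homomorphism `absGaloisRestrict K K_w : Γ_{K_w} → Γ_K` (restriction through the chosen
embedding `absClosureEmbedding K K_w : K̄ → K̄_w`, file `AbsGaloisGroup.lean`).  This file identifies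
the image: **for the non-trivial element `σ` of `Γ_{K_w} = Gal(K̄_w/K_w) ≅ Gal(ℂ/ℝ)`, the element
`absGaloisRestrict K K_w σ ∈ Γ_K` is a complex conjugation AT THE PLACE `w`** in the sense of the
tree's `IsComplexConjugationAt` (`AbsGaloisGroup.lean`): there is an embedding `ι : K̄ →+* ℂ` lying
over `w.embedding` with `ι (res σ • x) = conj (ι x)` — namely `ι = φ ∘ absClosureEmbedding` for the
`K_w`-isomorphism `φ : K̄_w ≃ ℂ` (`ℂ` is an algebraic closure of `K_w ≅ ℝ`), under which `σ` becomes
an `ℝ`-algebra automorphism of `ℂ`, i.e. complex conjugation (Mathlib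
`Complex.real_algHom_eq_id_or_conj`; the pattern of the tree's
`ArchimedeanLocalDuality.smul_eq_inv_of_pow_eq_one_infinitePlace`).

* `isComplexConjugationAt_absGaloisRestrict_of_ne_one` — the statement above;
* `absGaloisRestrict_ne_one_of_isReal` — `res σ ≠ 1`, `absGaloisRestrict_mul_self_of_isReal` —
  `res σ * res σ = 1`;
* `exists_ne_one_forall_eq_of_isReal` — at a real place `Γ_{K_w} = {1, σ}` with `σ ≠ 1`
  (`|Γ_{K_w}| ≤ 2`, `TateH2VanishingArchimedean`; `σ ≠ 1` exists as a complex conjugation of `Γ_{K_w}`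
  for the real embedding `K_w ≅ ℝ`, `exists_isComplexConjugation`).

Consumer: the real-place surjectivity `H²(K, M) ↠ ⊕_{v real} H²(K_v, M)` (Milne I Cor. 4.16),
`GaloisCohomology/PoitouTateTwoRealPlacesSurjectiveHolds.lean`.

## References

* J.-P. Serre, *Cohomologie galoisienne* (1997), II §6.1 (localisation along `K̄ → K̄_v`), I §2.4
  (`G = Gal(ℂ/ℝ)`). [SerreGaloisCohomology1997]
* J. S. Milne, *Arithmetic Duality Theorems*, 2nd ed. (2006), I §4 p. 55 (the choice of an embedding
  of `K^s` into `K_v^s`). [MilneADT2006]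
-/

noncomputable section

open NumberField

universe u

namespace Literature.NumberTheory.GaloisRepresentations

open Field

variable {K : Type u} [Field K]

/-- **`ℂ` as an algebraic closure of a real completion, with the Galois transport**: for a real place
`w` there are a `K_w`-algebra structure on `ℂ` extending `K_w ≅ ℝ ⊂ ℂ` and a `K_w`-isomorphism
`φ : K̄_w ≃ ℂ` such that every NON-TRIVIAL `σ ∈ Γ_{K_w}` is carried to complex conjugation:
`φ (σ • y) = conj (φ y)`; moreover `φ` maps `K ⊆ K_w` by `w.embedding`.  (Auxiliary packaging.)
[cite: SerreGaloisCohomology1997, I §2.4] -/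
theorem exists_algEquiv_complex_of_isReal {w : InfinitePlace K} (hw : w.IsReal) :
    ∃ φ : AlgebraicClosure w.Completion ≃+* ℂ,
      (∀ k : K, φ (algebraMap K (AlgebraicClosure w.Completion) k) = w.embedding k) ∧
      ∀ σ : absoluteGaloisGroup w.Completion, σ ≠ 1 →
        ∀ y : AlgebraicClosure w.Completion, φ (σ • y) = starRingEnd ℂ (φ y) := by
  let e : w.Completion ≃+* ℝ := InfinitePlace.Completion.ringEquivRealOfIsReal hw
  letI : Algebra w.Completion ℂ := (Complex.ofRealHom.comp e.toRingHom).toAlgebra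
  have hrank : Module.finrank w.Completion ℂ = 2 := by
    rw [Algebra.finrank_eq_of_equiv_equiv e (RingEquiv.refl ℂ) (by ext; rfl),
      Complex.finrank_real_complex]
  haveI : FiniteDimensional w.Completion ℂ :=
    Module.finite_of_finrank_pos (by rw [hrank]; exact two_pos)
  haveI : IsAlgClosure w.Completion ℂ := ⟨Complex.isAlgClosed, Algebra.IsAlgebraic.of_finite _ _⟩
  have hsurj : ∀ r : ℝ, ∃ a : w.Completion, algebraMap w.Completion ℂ a = r := fun r =>
    ⟨e.symm r, by
      change Complex.ofRealHom (e (e.symm r)) = r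
      rw [e.apply_symm_apply]; rfl⟩
  let φ : AlgebraicClosure w.Completion ≃ₐ[w.Completion] ℂ := IsAlgClosure.equiv w.Completion _ ℂ
  refine ⟨φ.toRingEquiv, fun k => ?_, fun σ hσ y => ?_⟩
  · -- `φ` is `K_w`-linear and `K → K_w → ℂ` is `w.embedding`
    change φ (algebraMap K (AlgebraicClosure w.Completion) k) = w.embedding k
    rw [IsScalarTower.algebraMap_apply K w.Completion (AlgebraicClosure w.Completion) k,
      AlgEquiv.commutes]
    change Complex.ofRealHom (e (algebraMap K w.Completion k)) = w.embedding k
    have he : e (algebraMap K w.Completion k) = w.embedding_of_isReal hw k := by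
      rw [InfinitePlace.Completion.ringEquivRealOfIsReal_apply, InfinitePlace.Completion.algebraMap_apply]
      exact InfinitePlace.Completion.extensionEmbeddingOfIsReal_coe hw (WithAbs.toAbs w.1 k)
    rw [he]
    exact InfinitePlace.embedding_of_isReal_apply hw k
  · -- the transported automorphism is `ℝ`-linear, hence `id` or `conj`; not `id` as `σ ≠ 1`
    let τ : ℂ ≃ₐ[w.Completion] ℂ := AlgEquiv.autCongr φ (absoluteGaloisGroup.toAlgEquiv _ σ)
    have hτ : ∀ z : ℂ, τ z = φ (σ • φ.symm z) := fun z => rfl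
    have hτ_real : ∀ r : ℝ, τ (r : ℂ) = r := fun r => by
      obtain ⟨a, ha⟩ := hsurj r
      rw [← ha]
      exact τ.commutes a
    let τℝ : ℂ →ₐ[ℝ] ℂ :=
      { (τ : ℂ ≃ₐ[w.Completion] ℂ).toRingEquiv.toRingHom with commutes' := hτ_real }
    have hτℝ : ∀ z, τℝ z = τ z := fun _ => rfl
    rcases Complex.real_algHom_eq_id_or_conj τℝ with hid | hconj
    · exfalso
      refine hσ (FaithfulSMul.eq_of_smul_eq_smul (α := AlgebraicClosure w.Completion) fun y => ?_)
      rw [one_smul]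
      apply φ.injective
      have h := congrArg (fun f : ℂ →ₐ[ℝ] ℂ => f (φ y)) hid
      simp only [hτℝ, AlgHom.id_apply] at h
      rw [hτ, AlgEquiv.symm_apply_apply] at h
      exact h
    · have h := congrArg (fun f : ℂ →ₐ[ℝ] ℂ => f (φ y)) hconj
      change τ (φ y) = (starRingEnd ℂ) (φ y) at h
      rw [hτ, AlgEquiv.symm_apply_apply] at h
      exact h

/-- **At a real place, the restriction to `Γ_K` of the non-trivial element of `Γ_{K_w}` is a complex
conjugation at `w`** (`IsComplexConjugationAt`): the embedding `ι = φ ∘ (K̄ → K̄_w) : K̄ → ℂ` lies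
over `w.embedding` and `ι (res σ • x) = conj (ι x)` (`absGaloisRestrict_apply_smul`).
Ref: Serre, *Cohomologie galoisienne* II §6.1; Milne, *ADT* I §4 (p. 55).
[cite: SerreGaloisCohomology1997, II §6.1] [cite: MilneADT2006, Ch. I §4 (p. 55)] -/
theorem isComplexConjugationAt_absGaloisRestrict_of_ne_one {w : InfinitePlace K} (hw : w.IsReal)
    {σ : absoluteGaloisGroup w.Completion} (hσ : σ ≠ 1) :
    IsComplexConjugationAt hw (absGaloisRestrict K w.Completion σ) := by
  obtain ⟨φ, hφK, hφσ⟩ := exists_algEquiv_complex_of_isReal hw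
  rw [isComplexConjugationAt_iff]
  let ι : AlgebraicClosure K →+* ℂ :=
    φ.toRingHom.comp (absClosureEmbedding K w.Completion).toRingHom
  have hι : ∀ x, ι x = φ (absClosureEmbedding K w.Completion x) := fun _ => rfl
  refine ⟨ι, ComplexEmbedding.liesOver_iff.mpr ?_, ?_⟩
  · ext1 k
    rw [RingHom.comp_apply, hι, AlgHom.commutes, hφK]
  · refine RingHom.ext fun x => ?_
    rw [ComplexEmbedding.conjugate_coe_eq, RingHom.comp_apply]
    change starRingEnd ℂ (ι x) = ι (absGaloisRestrict K w.Completion σ • x)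
    rw [hι, hι, absGaloisRestrict_apply_smul, hφσ σ hσ]

/-- At a real place the restriction of the non-trivial element of `Γ_{K_w}` is `≠ 1` in `Γ_K`
(a complex conjugation moves `√-1 ∈ K̄`). [cite: SerreGaloisCohomology1997, II §6.1] -/
theorem absGaloisRestrict_ne_one_of_isReal {w : InfinitePlace K} (hw : w.IsReal)
    {σ : absoluteGaloisGroup w.Completion} (hσ : σ ≠ 1) :
    absGaloisRestrict K w.Completion σ ≠ 1 :=
  (isComplexConjugationAt_absGaloisRestrict_of_ne_one hw hσ).ne_one

/-- At a real place the restriction `c` of the non-trivial element of `Γ_{K_w}` is an involution of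
`Γ_K`: `c * c = 1`. [cite: SerreGaloisCohomology1997, II §6.1] -/
theorem absGaloisRestrict_mul_self_of_isReal {w : InfinitePlace K} (hw : w.IsReal)
    {σ : absoluteGaloisGroup w.Completion} (hσ : σ ≠ 1) :
    absGaloisRestrict K w.Completion σ * absGaloisRestrict K w.Completion σ = 1 := by
  rw [← pow_two]
  exact (isComplexConjugationAt_absGaloisRestrict_of_ne_one hw hσ).sq_eq_one

/-- **At a real place `Γ_{K_w} = {1, σ}` with `σ ≠ 1`**: there is a non-trivial element (complex
conjugation, transported along `K̄_w ≃ ℂ`) and every element is `1` or it (`|Γ_{K_w}| ≤ 2`).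
[cite: SerreGaloisCohomology1997, I §2.4] -/
theorem exists_ne_one_forall_eq_of_isReal {w : InfinitePlace K} (hw : w.IsReal) :
    ∃ σ : absoluteGaloisGroup w.Completion, σ ≠ 1 ∧
      ∀ τ : absoluteGaloisGroup w.Completion, τ = 1 ∨ τ = σ := by
  haveI := finite_absoluteGaloisGroup_completion_infinitePlace w
  have hle := natCard_absoluteGaloisGroup_completion_infinitePlace_le_two w
  -- a complex conjugation of `Γ_{K_w}` for the real embedding `K_w ≅ ℝ` is non-trivial
  let e : w.Completion ≃+* ℝ := InfinitePlace.Completion.ringEquivRealOfIsReal hw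
  obtain ⟨σ₀, hσ₀⟩ := exists_isComplexConjugation (K := w.Completion) e.toRingHom
  refine ⟨σ₀, hσ₀.ne_one, fun τ => ?_⟩
  by_cases hτ : τ = 1
  · exact Or.inl hτ
  · exact Or.inr (eq_of_ne_one_of_natCard_le_two hle hτ hσ₀.ne_one)

end Literature.NumberTheory.GaloisRepresentations

end
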